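import Literature.AlgebraicGeometry.HodgeTheory.MotivatedGaloisGroup
import Literature.AlgebraicGeometry.HodgeTheory.HodgeTypeProjectors
import Literature.AlgebraicGeometry.HodgeTheory.HodgeTypeExteriorProduct
import Literature.AlgebraicGeometry.HodgeTheory.HodgeTypeConjugation
import Literature.AlgebraicGeometry.HodgeTheory.CoefficientRingHomTwist
import Literature.NumberTheory.Transcendental.DeRhamTheoremMultiplicative
import HarnessLib

/-!
# Galois-twisted Hodge operators lie in the Hodge group (Deligne 1982, I §3: the conjugates `σμ` of the Hodge cocharacter)

Family `hodge`, layer `Literature/AlgebraicGeometry/HodgeTheory`. P. Deligne, *Hodge cycles on abelian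
varieties* (notes by J. S. Milne), LNM 900 (1982), I §3: the Mumford–Tate group `G` of a rational Hodge
structure `V` is the smallest `ℚ`-algebraic subgroup of `GL(V) × 𝔾_m` containing the image of the
Hodge cocharacter `μ : 𝔾_m → GL(V_ℂ)` (`μ(z)` acts on `V^{p,q}` by `z^{-p}`), and (proof of Prop. 3.4,
TeXed re-edition p. 24) `G_ℂ` is generated by the conjugates `σμ`, `σ ∈ Aut(ℂ)`; in particular every
`σ`-CONJUGATE OF A HODGE OPERATOR fixes the rational tensors of type `(0,0)` — it lies in the (special)
Mumford–Tate group. This file proves that statement on the tree's real carriers, for the Tannaka-free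
Hodge group `hodgeGroup n X ≤ ∏ₖ GL(Hᵏ(X(ℂ); ℂ))` of `MotivatedGaloisGroup` (the `g` whose Künneth
extension to all powers `X^{×(a+1)}` fixes every rational `(p,p)`-class): it supplies the FIRST
non-scalar elements of `hodgeGroup` constructed in the tree.

For a Hodge model `M` of the smooth projective `n`-fold `X/ℂ` (`HodgeTypeProjectors`: type pieces
`M.typePiece k (p,q)`, projectors `M.typeProj`, `Hᵏ(X(ℂ); ℂ) = ⊕_{p+q=k} H^{p,q}`) and `t ∈ ℂˣ`:

* `M.hodgeOperator t k = Σ_{p+q=k} tᵖ t^{-q} π_{(p,q)}` — the **Hodge operator** (the `ℂ`-point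
  `(t⁻¹, t)` of the Deligne torus `𝕊_ℂ ≅ 𝔾_m × 𝔾_m`, acting on `H^{p,q}` by `tᵖ t^{-q} = t^{p-q}`; it is
  `μ(t⁻¹) · \overline{μ}(t)`): independent of the model (`hodgeOperator_eq_of_hodgeModel`), a
  one-parameter group (`hodgeOperator_mul`, `hodgeOperator_one`), FIXING the classes of type `(p,p)`,
  NATURAL for pull-backs along morphisms of smooth projective varieties (`map_hodgeOperator`, Voisin I
  §7.3.2) and MULTIPLICATIVE for the cup product (`hodgeOperator_cupProduct`, types add: Voisin I Thm.
  5.29 / §7.1.2 — the tree's `CupPreservesHodgeType`, a theorem via the multiplicative de Rham theorem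
  `exists_deRhamIsoFamily_holds`);
* `M.twistedHodgeOperator σ t k = σ_* ∘ h_t ∘ σ⁻¹_*` for a field automorphism `σ` of `ℂ`, where
  `σ_* = coeffClass σ` twists the COEFFICIENTS of `Hᵏ(X(ℂ); ℂ) = Hᵏ(X(ℂ); ℚ) ⊗ ℂ`
  (`CoefficientRingHomTwist`: semilinear, multiplicative, natural, fixing rational classes) — a
  `ℂ`-LINEAR automorphism acting on the twisted piece `σ_* H^{p,q}` by `tᵖ t^{-q}`: Deligne's `σμ`;
* **`twistedHodgeOperator_mem_hodgeGroup`** — `(σ_* h_t σ⁻¹_*)_k ∈ hodgeGroup n X`: its Künneth family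
  is the same operator on every power `X^{×(a+1)}` (read in any Hodge model of the power,
  `twistedHodgeFamily`), compatible with cross products by naturality + multiplicativity, and it fixes
  every RATIONAL class of type `(p,p)` of every power (`σ⁻¹_* c = c`, `h_t c = c`, `σ_* c = c`);
  `hodgeOperator_mem_hodgeGroup` is the case `σ = 1`.

Consumer: `Deligne1982/HodgeGroupCommutantHOne` (Deligne I Prop. 5.1, proof: the commutant of the Hodge
group on `H¹` of an abelian variety is `End⁰(A) ⊗ ℂ`, granted Riemann's theorem), which is the shared
Riemann junction of the Hodge ladder (stage 2 `CorCM/Interfaces` binder `hR`, stage 3 residual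
`Ring2Transport.HodgeGroupH1CommutantSpan`). No named facts are introduced (D-0026).

## References

* [Deligne1982HodgeCycles] P. Deligne, *Hodge cycles on abelian varieties*, LNM 900 (1982), I §3:
  definition of the Mumford–Tate group (before Prop. 3.4), Prop. 3.4 and its proof (`σμ`), the special
  Mumford–Tate group `G⁰` (before Thm. 3.8).
* [VoisinHodgeI2002] C. Voisin, *Hodge Theory and Complex Algebraic Geometry I* (2002), Thm. 5.29,
  §6.1.3, Thm. 6.18, §7.1.1–7.1.2, §7.3.2, §11.3.2.
-/

noncomputable section

open CategoryTheory AlgebraicGeometry MonoidalCategory CartesianMonoidalCategory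
open scoped Manifold
open Literature.AlgebraicTopology.SingularHomology

namespace Literature.AlgebraicGeometry.HodgeTheory

section HodgeTheory

variable {n : ℕ} {X : Motives.SchemeOver ℂ}

/-! ### Linear maps determined by their values on the type pieces -/

namespace HodgeModel

variable (M : HodgeModel n X)

/-- Two `ℂ`-linear maps out of `Hᵏ(X(ℂ); ℂ)` agreeing on every type piece `H^{p,q}_M` agree (the
pieces span: `c = Σ π_{(p,q)} c`). [cite: VoisinHodgeI2002, Thm. 6.18 and §7.1.1] -/
theorem linearMap_ext_of_typePiece {k : ℕ} {N : Type*} [AddCommGroup N] [Module ℂ N]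
    {f g : complexBetti X k →ₗ[ℂ] N}
    (h : ∀ (pq : ↥(Finset.HasAntidiagonal.antidiagonal k)), ∀ c ∈ M.typePiece k pq, f c = g c) :
    f = g := by
  refine LinearMap.ext fun c ↦ ?_
  rw [← M.sum_typeProj k c, map_sum, map_sum]
  exact Finset.sum_congr rfl fun pq _ ↦ h pq _ (M.typeProj_mem k pq c)

/-- The type pieces do not depend on the Hodge model (`X` smooth projective): membership in
`M.typePiece k (p,q)` is the Hodge type `(p,q)`, which may be read in any model
(`isOfHodgeType_iff_mem_hodgePQ`, from the tree's `hodgePQ_independent_of_hodgeModel_holds`).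
[cite: VoisinHodgeI2002, Prop. 6.11 and §7.1.1] -/
theorem mem_typePiece_iff_isOfHodgeType' (hX : Motives.IsSmoothProjective n X) {k : ℕ}
    (pq : ↥(Finset.HasAntidiagonal.antidiagonal k)) (c : complexBetti X k) :
    c ∈ M.typePiece k pq ↔ IsOfHodgeType n X k pq.1.1 pq.1.2 c :=
  (M.mem_typePiece_iff pq c).trans (isOfHodgeType_iff_mem_hodgePQ hX M c).symm

/-- Two Hodge models of a smooth projective variety have the same type pieces. [cite: VoisinHodgeI2002, Prop. 6.11] -/
theorem typePiece_eq_of_hodgeModel (hX : Motives.IsSmoothProjective n X) (M' : HodgeModel n X) (k : ℕ) :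
    M.typePiece k = M'.typePiece k := by
  funext pq
  ext c
  rw [M.mem_typePiece_iff_isOfHodgeType' hX, M'.mem_typePiece_iff_isOfHodgeType' hX]

/-! ### The Hodge operator `h_t = Σ tᵖ t^{-q} π_{(p,q)}` -/

/-- The weight `tᵖ · (t⁻¹)^q` of the type `(p, q)` under the Hodge operator `h_t`. [cite: Deligne1982HodgeCycles, I §3 (the cocharacter `μ`)] -/
def hodgeWeight (t : ℂˣ) {k : ℕ} (pq : ↥(Finset.HasAntidiagonal.antidiagonal k)) : ℂ :=
  (t : ℂ) ^ pq.1.1 * ((t⁻¹ : ℂˣ) : ℂ) ^ pq.1.2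

/-- `hodgeWeight 1 = 1`. [folklore] -/
@[simp] private theorem hodgeWeight_one {k : ℕ} (pq : ↥(Finset.HasAntidiagonal.antidiagonal k)) :
    hodgeWeight 1 pq = 1 := by
  simp [hodgeWeight]

/-- The weights are multiplicative in `t`. [folklore] -/
private theorem hodgeWeight_mul (s t : ℂˣ) {k : ℕ} (pq : ↥(Finset.HasAntidiagonal.antidiagonal k)) :
    hodgeWeight (s * t) pq = hodgeWeight s pq * hodgeWeight t pq := by
  simp only [hodgeWeight, mul_inv, Units.val_mul, mul_pow]
  ring

/-- The weight of the type `(p, p)` is `1`. [folklore] -/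
private theorem hodgeWeight_eq_one_of_fst_eq_snd (t : ℂˣ) {k : ℕ} (pq : ↥(Finset.HasAntidiagonal.antidiagonal k))
    (h : pq.1.1 = pq.1.2) : hodgeWeight t pq = 1 := by
  rw [hodgeWeight, h, ← mul_pow, ← Units.val_mul, mul_inv_cancel, Units.val_one, one_pow]

/-- The weights add under addition of types: for `(p, q)` on the antidiagonal of `i`, `(p', q')` on that
of `j` and `(p + p', q + q')` on that of `k`, `w(p+p', q+q') = w(p,q) · w(p',q')`. [folklore] -/
private theorem hodgeWeight_add (t : ℂˣ) {i j k : ℕ} (pq : ↥(Finset.HasAntidiagonal.antidiagonal i))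
    (pq' : ↥(Finset.HasAntidiagonal.antidiagonal j)) (r : ↥(Finset.HasAntidiagonal.antidiagonal k))
    (h₁ : r.1.1 = pq.1.1 + pq'.1.1) (h₂ : r.1.2 = pq.1.2 + pq'.1.2) :
    hodgeWeight t r = hodgeWeight t pq * hodgeWeight t pq' := by
  simp only [hodgeWeight, h₁, h₂, pow_add]
  ring

/-- **The Hodge operator** `h_t = Σ_{p+q=k} tᵖ t^{-q} π_{(p,q)}` on `Hᵏ(X(ℂ); ℂ)`, read in the Hodge
model `M` — the action of the `ℂ`-point `(t⁻¹, t)` of the Deligne torus through the Hodge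
decomposition (`μ(z)` acts on `H^{p,q}` by `z^{-p}`; Deligne I §3). [cite: Deligne1982HodgeCycles, I §3 (definition preceding Prop. 3.4)] -/
def hodgeOperator (t : ℂˣ) (k : ℕ) : complexBetti X k →ₗ[ℂ] complexBetti X k :=
  ∑ pq : ↥(Finset.HasAntidiagonal.antidiagonal k), hodgeWeight t pq • M.typeProj k pq

/-- **On a class of type `(p, q)` the Hodge operator is the scalar `tᵖ t^{-q}`.**
[cite: Deligne1982HodgeCycles, I §3 (definition preceding Prop. 3.4)] -/
theorem hodgeOperator_apply_of_mem (t : ℂˣ) {k : ℕ} {pq : ↥(Finset.HasAntidiagonal.antidiagonal k)}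
    {c : complexBetti X k} (hc : c ∈ M.typePiece k pq) :
    M.hodgeOperator t k c = hodgeWeight t pq • c := by
  classical
  rw [hodgeOperator, LinearMap.sum_apply, Finset.sum_eq_single pq]
  · rw [LinearMap.smul_apply, M.typeProj_apply_of_mem hc]
  · intro pq' _ hne
    rw [LinearMap.smul_apply, M.typeProj_apply_of_mem_ne (Ne.symm hne) hc, smul_zero]
  · intro h
    exact absurd (Finset.mem_univ pq) h

/-- `h_1 = id` (`μ` is a homomorphism). [cite: Deligne1982HodgeCycles, I §3 (the cocharacter `μ : 𝔾_m → G_ℂ`)] -/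
theorem hodgeOperator_one (k : ℕ) : M.hodgeOperator 1 k = LinearMap.id :=
  M.linearMap_ext_of_typePiece fun pq c hc ↦ by
    rw [M.hodgeOperator_apply_of_mem 1 hc, hodgeWeight_one, one_smul, LinearMap.id_apply]

/-- `h_{st} = h_s ∘ h_t`: `t ↦ h_t` is a homomorphism `ℂˣ → GL(Hᵏ(X(ℂ); ℂ))` (the cocharacter `μ`). [cite: Deligne1982HodgeCycles, I §3 (the cocharacter `μ : 𝔾_m → G_ℂ`)] -/
theorem hodgeOperator_mul (s t : ℂˣ) (k : ℕ) :
    M.hodgeOperator (s * t) k = M.hodgeOperator s k ∘ₗ M.hodgeOperator t k :=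
  M.linearMap_ext_of_typePiece fun pq c hc ↦ by
    rw [LinearMap.comp_apply, M.hodgeOperator_apply_of_mem t hc, map_smul,
      M.hodgeOperator_apply_of_mem s hc, M.hodgeOperator_apply_of_mem (s * t) hc, smul_smul,
      hodgeWeight_mul, mul_comm]

/-- `h_{t⁻¹} (h_t c) = c` (`μ` is a homomorphism). [cite: Deligne1982HodgeCycles, I §3 (the cocharacter `μ : 𝔾_m → G_ℂ`)] -/
@[simp] theorem hodgeOperator_inv_apply (t : ℂˣ) (k : ℕ) (c : complexBetti X k) :
    M.hodgeOperator t⁻¹ k (M.hodgeOperator t k c) = c := by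
  rw [← LinearMap.comp_apply, ← hodgeOperator_mul, inv_mul_cancel, hodgeOperator_one, LinearMap.id_apply]

/-- `h_t (h_{t⁻¹} c) = c` (`μ` is a homomorphism). [cite: Deligne1982HodgeCycles, I §3 (the cocharacter `μ : 𝔾_m → G_ℂ`)] -/
@[simp] theorem hodgeOperator_apply_inv (t : ℂˣ) (k : ℕ) (c : complexBetti X k) :
    M.hodgeOperator t k (M.hodgeOperator t⁻¹ k c) = c := by
  rw [← LinearMap.comp_apply, ← hodgeOperator_mul, mul_inv_cancel, hodgeOperator_one, LinearMap.id_apply]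

/-- **The Hodge operator fixes the classes of type `(p, p)`** (weight `tᵖ t^{-p} = 1`).
[cite: Deligne1982HodgeCycles, I §3 (rational tensors of type (0,0) are fixed)] -/
theorem hodgeOperator_apply_of_mem_of_fst_eq_snd (t : ℂˣ) {k : ℕ}
    {pq : ↥(Finset.HasAntidiagonal.antidiagonal k)} (hpq : pq.1.1 = pq.1.2)
    {c : complexBetti X k} (hc : c ∈ M.typePiece k pq) : M.hodgeOperator t k c = c := by
  rw [M.hodgeOperator_apply_of_mem t hc, hodgeWeight_eq_one_of_fst_eq_snd t pq hpq, one_smul]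

/-- The Hodge operator of a class of Hodge type `(p, p)` in degree `2p` is the class itself.
[cite: Deligne1982HodgeCycles, I §3 (rational tensors of type (0,0) are fixed)] -/
theorem hodgeOperator_apply_of_isOfHodgeType (hX : Motives.IsSmoothProjective n X) (t : ℂˣ) {p : ℕ}
    {c : complexBetti X (2 * p)} (hc : IsOfHodgeType n X (2 * p) p p c) :
    M.hodgeOperator t (2 * p) c = c := by
  let pp : ↥(Finset.HasAntidiagonal.antidiagonal (2 * p)) :=
    ⟨(p, p), Finset.HasAntidiagonal.mem_antidiagonal.2 (by omega)⟩
  exact M.hodgeOperator_apply_of_mem_of_fst_eq_snd t (pq := pp) rfl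
    ((M.mem_typePiece_iff_isOfHodgeType' hX pp c).2 hc)

/-- **The Hodge operator does not depend on the Hodge model** (`X` smooth projective).
[cite: VoisinHodgeI2002, Prop. 6.11] -/
theorem hodgeOperator_eq_of_hodgeModel (hX : Motives.IsSmoothProjective n X) (M' : HodgeModel n X)
    (t : ℂˣ) (k : ℕ) : M.hodgeOperator t k = M'.hodgeOperator t k :=
  M.linearMap_ext_of_typePiece fun pq c hc ↦ by
    rw [M.hodgeOperator_apply_of_mem t hc,
      M'.hodgeOperator_apply_of_mem t (by rwa [← M.typePiece_eq_of_hodgeModel hX M'])]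

/-- **The Hodge operator is natural**: for a morphism `f : Y ⟶ X` of smooth projective varieties,
`f^* ∘ h_t = h_t ∘ f^*` (pull-backs preserve Hodge types, Voisin I §7.3.2; read in any models).
[cite: VoisinHodgeI2002, §7.3.2] -/
theorem map_hodgeOperator {m : ℕ} {Y : Motives.SchemeOver ℂ} (hY : Motives.IsSmoothProjective m Y)
    (hX : Motives.IsSmoothProjective n X) (MY : HodgeModel m Y) (f : Y ⟶ X) (t : ℂˣ) (k : ℕ)
    (c : complexBetti X k) :
    complexBetti.map f k (M.hodgeOperator t k c) = MY.hodgeOperator t k (complexBetti.map f k c) := by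
  have h : (complexBetti.map f k).hom ∘ₗ M.hodgeOperator t k =
      MY.hodgeOperator t k ∘ₗ (complexBetti.map f k).hom :=
    M.linearMap_ext_of_typePiece fun pq c hc ↦ by
      have hfc : complexBetti.map f k c ∈ MY.typePiece k pq :=
        (MY.mem_typePiece_iff_isOfHodgeType' hY pq _).2
          (((M.mem_typePiece_iff_isOfHodgeType' hX pq c).1 hc).map_of_isSmoothProjective hY hX f)
      rw [LinearMap.comp_apply, LinearMap.comp_apply, M.hodgeOperator_apply_of_mem t hc,
        MY.hodgeOperator_apply_of_mem t hfc]
      exact map_smul (complexBetti.map f k).hom _ _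
  exact LinearMap.congr_fun h c

/-- **The Hodge operator is multiplicative**: `h_t (a ⌣ b) = h_t a ⌣ h_t b` (the cup product of a
class of type `(p, q)` with a class of type `(p', q')` has type `(p + p', q + q')`, Voisin I Thm. 5.29 /
§7.1.2 — the tree's `CupPreservesHodgeType`, a theorem through the multiplicative de Rham theorem —
and the weights multiply). [cite: VoisinHodgeI2002, §5.3.2 Thm. 5.29 and §7.1.2] -/
theorem hodgeOperator_cupProduct (hX : Motives.IsSmoothProjective n X) (t : ℂˣ) {i j k : ℕ}
    (h : i + j = k) (a : complexBetti X i) (b : complexBetti X j) :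
    M.hodgeOperator t k (cupProduct h a b) =
      cupProduct h (M.hodgeOperator t i a) (M.hodgeOperator t j b) := by
  have hcup : CupPreservesHodgeType n X :=
    cupPreservesHodgeType_of_multiplicative_deRham
      (fun E _ _ _ ↦ Literature.NumberTheory.Transcendental.exists_deRhamIsoFamily_holds E) hX
  -- both sides are bilinear in `(a, b)`; compare them on pairs of type pieces
  suffices H : ∀ (pq : ↥(Finset.HasAntidiagonal.antidiagonal i)), ∀ a ∈ M.typePiece i pq,
      M.hodgeOperator t k (cupProduct h a b) =
        cupProduct h (M.hodgeOperator t i a) (M.hodgeOperator t j b) by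
    rw [← M.sum_typeProj i a]
    simp only [map_sum, LinearMap.sum_apply]
    exact Finset.sum_congr rfl fun pq _ ↦ H pq _ (M.typeProj_mem i pq a)
  intro pq a ha
  suffices H : ∀ (pq' : ↥(Finset.HasAntidiagonal.antidiagonal j)), ∀ b ∈ M.typePiece j pq',
      M.hodgeOperator t k (cupProduct h a b) =
        cupProduct h (M.hodgeOperator t i a) (M.hodgeOperator t j b) by
    rw [← M.sum_typeProj j b]
    simp only [map_sum]
    exact Finset.sum_congr rfl fun pq' _ ↦ H pq' _ (M.typeProj_mem j pq' b)
  intro pq' b hb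
  -- `a ⌣ b` has type `(p + p', q + q')`
  have hi := Finset.HasAntidiagonal.mem_antidiagonal.1 pq.2
  have hj := Finset.HasAntidiagonal.mem_antidiagonal.1 pq'.2
  let r : ↥(Finset.HasAntidiagonal.antidiagonal k) :=
    ⟨(pq.1.1 + pq'.1.1, pq.1.2 + pq'.1.2), Finset.HasAntidiagonal.mem_antidiagonal.2 (by omega)⟩
  have hab : cupProduct h a b ∈ M.typePiece k r :=
    (M.mem_typePiece_iff_isOfHodgeType' hX r _).2
      (hcup h ((M.mem_typePiece_iff_isOfHodgeType' hX pq a).1 ha)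
        ((M.mem_typePiece_iff_isOfHodgeType' hX pq' b).1 hb))
  rw [M.hodgeOperator_apply_of_mem t hab, M.hodgeOperator_apply_of_mem t ha,
    M.hodgeOperator_apply_of_mem t hb, LinearMap.map_smul₂, map_smul, smul_smul,
    hodgeWeight_add t pq pq' r rfl rfl]

/-! ### The Galois-twisted Hodge operators `σ_* h_t σ⁻¹_*` -/

/-- **The `σ`-twisted Hodge operator** `σ_* ∘ h_t ∘ σ⁻¹_*` on `Hᵏ(X(ℂ); ℂ)` for a field automorphism
`σ` of `ℂ` (`σ_* = coeffClass σ`, the twist of the coefficients of `Hᵏ(X(ℂ); ℚ) ⊗ ℂ`): a `ℂ`-LINEAR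
automorphism (two semilinear twists cancel) acting on the twisted piece `σ_* H^{p,q}` by `tᵖ t^{-q}` —
Deligne's conjugate `σμ` of the Hodge cocharacter. [cite: Deligne1982HodgeCycles, I §3, proof of Prop. 3.4] -/
def twistedHodgeOperator (σ : ℂ ≃+* ℂ) (t : ℂˣ) (k : ℕ) : complexBetti X k ≃ₗ[ℂ] complexBetti X k where
  toFun c := coeffClass (R := ℂ) (S := ℂ) σ.toRingHom.toAddMonoidHom k
    (M.hodgeOperator t k (coeffClass (R := ℂ) (S := ℂ) σ.symm.toRingHom.toAddMonoidHom k c))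
  invFun c := coeffClass (R := ℂ) (S := ℂ) σ.toRingHom.toAddMonoidHom k
    (M.hodgeOperator t⁻¹ k (coeffClass (R := ℂ) (S := ℂ) σ.symm.toRingHom.toAddMonoidHom k c))
  map_add' c c' := by simp only [map_add]
  map_smul' a c := by
    rw [coeffClass_ringHom_smul, map_smul, coeffClass_ringHom_smul, RingHom.id_apply]
    congr 1
    exact σ.apply_symm_apply a
  left_inv c := by
    dsimp only
    rw [coeffClass_ringEquiv_symm_apply, hodgeOperator_inv_apply, coeffClass_ringEquiv_apply_symm]
  right_inv c := by
    dsimp only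
    rw [coeffClass_ringEquiv_symm_apply, hodgeOperator_apply_inv, coeffClass_ringEquiv_apply_symm]

/-- Unfolding the twisted Hodge operator `σμ = σ_* ∘ h_t ∘ σ⁻¹_*`. [cite: Deligne1982HodgeCycles, I §3, proof of Prop. 3.4] -/
theorem twistedHodgeOperator_apply (σ : ℂ ≃+* ℂ) (t : ℂˣ) (k : ℕ) (c : complexBetti X k) :
    M.twistedHodgeOperator σ t k c = coeffClass (R := ℂ) (S := ℂ) σ.toRingHom.toAddMonoidHom k
      (M.hodgeOperator t k (coeffClass (R := ℂ) (S := ℂ) σ.symm.toRingHom.toAddMonoidHom k c)) :=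
  rfl

/-- The conjugation relation `σ⁻¹_* ∘ (σ_* h_t σ⁻¹_*) = h_t ∘ σ⁻¹_*`. [cite: Deligne1982HodgeCycles, I §3, proof of Prop. 3.4] -/
theorem coeffClass_symm_twistedHodgeOperator (σ : ℂ ≃+* ℂ) (t : ℂˣ) (k : ℕ) (c : complexBetti X k) :
    coeffClass (R := ℂ) (S := ℂ) σ.symm.toRingHom.toAddMonoidHom k (M.twistedHodgeOperator σ t k c) =
      M.hodgeOperator t k (coeffClass (R := ℂ) (S := ℂ) σ.symm.toRingHom.toAddMonoidHom k c) := by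
  rw [twistedHodgeOperator_apply, coeffClass_ringEquiv_symm_apply]

/-- For the identity automorphism the twisted operator is the Hodge operator itself (`σ = 1`). [cite: Deligne1982HodgeCycles, I §3, proof of Prop. 3.4] -/
theorem twistedHodgeOperator_refl (t : ℂˣ) (k : ℕ) (c : complexBetti X k) :
    M.twistedHodgeOperator (RingEquiv.refl ℂ) t k c = M.hodgeOperator t k c := by
  rw [twistedHodgeOperator_apply]
  have e : (RingEquiv.refl ℂ).toRingHom.toAddMonoidHom = AddMonoidHom.id ℂ := AddMonoidHom.ext fun _ ↦ rfl
  have e' : (RingEquiv.refl ℂ).symm.toRingHom.toAddMonoidHom = AddMonoidHom.id ℂ :=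
    AddMonoidHom.ext fun _ ↦ rfl
  rw [e, e', coeffClass_id, coeffClass_id]

/-- The twisted Hodge operator does not depend on the Hodge model. [cite: VoisinHodgeI2002, Prop. 6.11] -/
theorem twistedHodgeOperator_eq_of_hodgeModel (hX : Motives.IsSmoothProjective n X) (M' : HodgeModel n X)
    (σ : ℂ ≃+* ℂ) (t : ℂˣ) (k : ℕ) : M.twistedHodgeOperator σ t k = M'.twistedHodgeOperator σ t k :=
  LinearEquiv.ext fun c ↦ by
    rw [twistedHodgeOperator_apply, twistedHodgeOperator_apply, M.hodgeOperator_eq_of_hodgeModel hX M']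

/-- **The twisted Hodge operator fixes every rational class of type `(p, p)`**: `σ⁻¹_* c = c` (rational),
`h_t c = c` (type `(p,p)`), `σ_* c = c`. [cite: Deligne1982HodgeCycles, I §3, proof of Prop. 3.4] -/
theorem twistedHodgeOperator_apply_of_isRationalClass_of_isOfHodgeType (hX : Motives.IsSmoothProjective n X)
    (σ : ℂ ≃+* ℂ) (t : ℂˣ) {p : ℕ} {c : complexBetti X (2 * p)} (hrat : IsRationalClass c)
    (htyp : IsOfHodgeType n X (2 * p) p p c) : M.twistedHodgeOperator σ t (2 * p) c = c := by
  rw [twistedHodgeOperator_apply, hrat.coeffClass_ringHom_eq, M.hodgeOperator_apply_of_isOfHodgeType hX t htyp,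
    hrat.coeffClass_ringHom_eq]

/-- **The twisted Hodge operator is natural** for morphisms `f : Y ⟶ X` of smooth projective varieties:
`f^* ∘ (σ_* h_t σ⁻¹_*)_X = (σ_* h_t σ⁻¹_*)_Y ∘ f^*` (naturality of `σ_*`, `coeffClass_map`, and of `h_t`).
[cite: VoisinHodgeI2002, §7.3.2] -/
theorem map_twistedHodgeOperator {m : ℕ} {Y : Motives.SchemeOver ℂ} (hY : Motives.IsSmoothProjective m Y)
    (hX : Motives.IsSmoothProjective n X) (MY : HodgeModel m Y) (f : Y ⟶ X) (σ : ℂ ≃+* ℂ) (t : ℂˣ) (k : ℕ)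
    (c : complexBetti X k) :
    complexBetti.map f k (M.twistedHodgeOperator σ t k c) =
      MY.twistedHodgeOperator σ t k (complexBetti.map f k c) := by
  have e₁ : ∀ z : complexBetti X k,
      complexBetti.map f k (coeffClass (R := ℂ) (S := ℂ) σ.toRingHom.toAddMonoidHom k z) =
        coeffClass (R := ℂ) (S := ℂ) σ.toRingHom.toAddMonoidHom k (complexBetti.map f k z) := fun z ↦
    (coeffClass_map (R := ℂ) (S := ℂ) σ.toRingHom.toAddMonoidHom
      (Motives.AlgPoints.mapContinuous (L := ℂ) f) z).symm
  have e₂ : ∀ z : complexBetti X k,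
      complexBetti.map f k (coeffClass (R := ℂ) (S := ℂ) σ.symm.toRingHom.toAddMonoidHom k z) =
        coeffClass (R := ℂ) (S := ℂ) σ.symm.toRingHom.toAddMonoidHom k (complexBetti.map f k z) := fun z ↦
    (coeffClass_map (R := ℂ) (S := ℂ) σ.symm.toRingHom.toAddMonoidHom
      (Motives.AlgPoints.mapContinuous (L := ℂ) f) z).symm
  rw [twistedHodgeOperator_apply, twistedHodgeOperator_apply, e₁, M.map_hodgeOperator hY hX MY f t k, e₂]

/-- **The twisted Hodge operator is multiplicative**: `g (a ⌣ b) = g a ⌣ g b` for `g = σ_* h_t σ⁻¹_*`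
(`σ_*`, `σ⁻¹_*` are multiplicative, `coeffClass_ringHom_cupProduct`, and so is `h_t`).
[cite: VoisinHodgeI2002, §5.3.2 Thm. 5.29 and §7.1.2] -/
theorem twistedHodgeOperator_cupProduct (hX : Motives.IsSmoothProjective n X) (σ : ℂ ≃+* ℂ) (t : ℂˣ)
    {i j k : ℕ} (h : i + j = k) (a : complexBetti X i) (b : complexBetti X j) :
    M.twistedHodgeOperator σ t k (cupProduct h a b) =
      cupProduct h (M.twistedHodgeOperator σ t i a) (M.twistedHodgeOperator σ t j b) := by
  rw [twistedHodgeOperator_apply, twistedHodgeOperator_apply, twistedHodgeOperator_apply,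
    coeffClass_ringHom_cupProduct, M.hodgeOperator_cupProduct hX, coeffClass_ringHom_cupProduct]

end HodgeModel

/-! ### The Künneth family on the powers `X^{×(a+1)}` and membership in the Hodge group -/

namespace HodgeModel

variable (M : HodgeModel n X)

/-- A Hodge model of every power `X^{×(a+1)}` of the smooth projective `X`: the given model `M` of
`X = X^{×1}` and, for `a ≥ 1`, some model of the smooth projective `X^{×(a+1)}`
(`isSmoothProjective_cartesianPow`, `nonempty_hodgeModel_holds`). [cite: SerreGAGA1956, §2] -/
def powModel (hX : Motives.IsSmoothProjective n X) :
    ∀ a : ℕ, HodgeModel (cartesianPowDim n a) (cartesianPow X (a + 1))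
  | 0 => M
  | a + 1 => (nonempty_hodgeModel_holds (isSmoothProjective_cartesianPow hX (a + 1))).some

/-- The **Künneth family of the twisted Hodge operator**: the twisted Hodge operator `σ_* h_t σ⁻¹_*`
of EVERY power `X^{×(a+1)}` (read in the models `powModel`). [cite: Deligne1982HodgeCycles, I §3, proof of Prop. 3.4] -/
def twistedHodgeFamily (hX : Motives.IsSmoothProjective n X) (σ : ℂ ≃+* ℂ) (t : ℂˣ) :
    ∀ a k : ℕ, complexBetti (cartesianPow X (a + 1)) k ≃ₗ[ℂ] complexBetti (cartesianPow X (a + 1)) k :=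
  fun a k ↦ (M.powModel hX a).twistedHodgeOperator σ t k

/-- **The twisted Hodge operators of the powers form a Künneth family**: on
`X^{×(a+2)} = X^{×(a+1)} ⊗ X`, `g (pr₁^* x ⌣ pr₂^* y) = pr₁^* (g x) ⌣ pr₂^* (g y)` — multiplicativity on
the product and naturality along the two projections (morphisms of smooth projective varieties).
[cite: Deligne1982HodgeCycles, I §3, proof of Prop. 3.4] [cite: VoisinHodgeI2002, §11.3.2 Thm. 11.38] -/
theorem isKunnethFamily_twistedHodgeFamily (hX : Motives.IsSmoothProjective n X) (σ : ℂ ≃+* ℂ) (t : ℂˣ) :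
    IsKunnethFamily X (M.twistedHodgeFamily hX σ t) := by
  refine ⟨fun a i j k h x y ↦ ?_⟩
  have hP : Motives.IsSmoothProjective (cartesianPowDim n (a + 1)) (cartesianPow X (a + 1 + 1)) :=
    isSmoothProjective_cartesianPow hX (a + 1)
  have hF : Motives.IsSmoothProjective (cartesianPowDim n a) (cartesianPow X (a + 1)) :=
    isSmoothProjective_cartesianPow hX a
  have e₁ := (M.powModel hX (a + 1)).twistedHodgeOperator_cupProduct hP σ t h
    (complexBetti.map (fst (cartesianPow X (a + 1)) X) i x)
    (complexBetti.map (snd (cartesianPow X (a + 1)) X) j y)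
  have e₂ := (M.powModel hX a).map_twistedHodgeOperator hP hF (M.powModel hX (a + 1))
    (fst (cartesianPow X (a + 1)) X) σ t i x
  have e₃ := M.map_twistedHodgeOperator hP hX (M.powModel hX (a + 1))
    (snd (cartesianPow X (a + 1)) X) σ t j y
  change (M.powModel hX (a + 1)).twistedHodgeOperator σ t k _ =
    cupProduct h (complexBetti.map (fst (cartesianPow X (a + 1)) X) i
        ((M.powModel hX a).twistedHodgeOperator σ t i x))
      (complexBetti.map (snd (cartesianPow X (a + 1)) X) j (M.twistedHodgeOperator σ t j y))
  refine e₁.trans ?_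
  exact congrArg₂ (fun u v ↦ cupProduct h u v) e₂.symm e₃.symm

/-- The Künneth family of the twisted Hodge operator fixes every rational `(p,p)`-class of every power.
[cite: Deligne1982HodgeCycles, I §3, proof of Prop. 3.4] -/
theorem twistedHodgeFamily_apply_of_mem_hodgePowClasses (hX : Motives.IsSmoothProjective n X)
    (σ : ℂ ≃+* ℂ) (t : ℂˣ) (a p : ℕ) {x : complexBetti (cartesianPow X (a + 1)) (2 * p)}
    (hx : x ∈ hodgePowClasses n X a p) : M.twistedHodgeFamily hX σ t a (2 * p) x = x :=
  (M.powModel hX a).twistedHodgeOperator_apply_of_isRationalClass_of_isOfHodgeType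
    (isSmoothProjective_cartesianPow hX a) σ t hx.1 hx.2

/-- **Galois-twisted Hodge operators lie in the Hodge group** (Deligne 1982, I §3, proof of Prop. 3.4:
the conjugates `σμ(𝔾_m)`, `σ ∈ Aut(ℂ)`, of the Hodge cocharacter lie in the Mumford–Tate group; here
for the special Mumford–Tate group = the tree's Tannaka-free `hodgeGroup n X`, and the weight-zero
operators `σ_* h_t σ⁻¹_*`, `h_t | σ_*H^{p,q} = tᵖ t^{-q}`): for every Hodge model `M` of the smooth
projective `n`-fold `X/ℂ`, every field automorphism `σ` of `ℂ` and every `t ∈ ℂˣ`, the family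
`(σ_* ∘ h_t ∘ σ⁻¹_*)_k ∈ ∏ₖ GL(Hᵏ(X(ℂ); ℂ))` belongs to `hodgeGroup n X`.
[cite: Deligne1982HodgeCycles, I §3, Prop. 3.4 and its proof] -/
theorem twistedHodgeOperator_mem_hodgeGroup (hX : Motives.IsSmoothProjective n X) (σ : ℂ ≃+* ℂ) (t : ℂˣ) :
    (fun k ↦ M.twistedHodgeOperator σ t k) ∈ hodgeGroup n X :=
  ⟨M.twistedHodgeFamily hX σ t, M.isKunnethFamily_twistedHodgeFamily hX σ t, rfl,
    fun a p _ hx ↦ M.twistedHodgeFamily_apply_of_mem_hodgePowClasses hX σ t a p hx⟩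

/-- **The Hodge operators lie in the Hodge group** (the case `σ = 1`: the weight-zero `ℂ`-points of the
Deligne torus belong to the special Mumford–Tate group). [cite: Deligne1982HodgeCycles, I §3, Prop. 3.4] -/
theorem hodgeOperator_mem_hodgeGroup (hX : Motives.IsSmoothProjective n X) (t : ℂˣ) :
    (fun k ↦ M.twistedHodgeOperator (RingEquiv.refl ℂ) t k) ∈ hodgeGroup n X :=
  M.twistedHodgeOperator_mem_hodgeGroup hX (RingEquiv.refl ℂ) t

end HodgeModel

/-! ### Consequence for the commutant of the Hodge group in one degree -/

/-- **An endomorphism commuting with the Hodge group commutes with every Galois-twisted Hodge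
operator**; equivalently its `σ⁻¹`-conjugate `σ⁻¹_* ∘ x ∘ σ_*` commutes with the Hodge operator `h_t`:
`σ⁻¹_* (x (σ_* c')) ` is an `h_t`-equivariant function of `c'` — stated on elements as
`σ⁻¹_* (x (σ_* (h_t c))) = h_t (σ⁻¹_* (x (σ_* c)))`. [cite: Deligne1982HodgeCycles, I §3, proof of Prop. 3.4] -/
theorem HodgeModel.coeffClass_apply_hodgeOperator_of_commute_hodgeGroup (M : HodgeModel n X)
    (hX : Motives.IsSmoothProjective n X) {k : ℕ} (x : complexBetti X k →ₗ[ℂ] complexBetti X k)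
    (hx : ∀ g ∈ hodgeGroup n X, ∀ y : complexBetti X k, x (g k y) = g k (x y))
    (σ : ℂ ≃+* ℂ) (t : ℂˣ) (c : complexBetti X k) :
    coeffClass (R := ℂ) (S := ℂ) σ.symm.toRingHom.toAddMonoidHom k
        (x (coeffClass (R := ℂ) (S := ℂ) σ.toRingHom.toAddMonoidHom k (M.hodgeOperator t k c))) =
      M.hodgeOperator t k (coeffClass (R := ℂ) (S := ℂ) σ.symm.toRingHom.toAddMonoidHom k
        (x (coeffClass (R := ℂ) (S := ℂ) σ.toRingHom.toAddMonoidHom k c))) := by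
  have h := hx _ (M.twistedHodgeOperator_mem_hodgeGroup hX σ t)
    (coeffClass (R := ℂ) (S := ℂ) σ.toRingHom.toAddMonoidHom k c)
  -- `g (σ_* c) = σ_* (h_t c)`
  simp only [HodgeModel.twistedHodgeOperator_apply, coeffClass_ringEquiv_symm_apply] at h
  rw [h, coeffClass_ringEquiv_symm_apply]

end HodgeTheory

end Literature.AlgebraicGeometry.HodgeTheory

end
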